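import Literature.Topology.FourManifolds.SurfaceGroupRestrictionForm
import Literature.Topology.FourManifolds.SurfaceGroupEpimorphismsStandard
import Literature.GroupTheory.CombinatorialGroupTheory.SchreierIndexFormula
import Literature.GroupTheory.CombinatorialGroupTheory.SurfaceGroupConjugacySeparable
import Mathlib.Data.ZMod.Basic
import HarnessLib

/-!
# Finite-index subgroups of surface groups, V: restriction of the Heisenberg obstruction has degree
# `± [S_g : K]`

Topic `Literature/Topology/FourManifolds`; theorems only.  For a pair of characters
`Φ = (Φ₁, Φ₂) : S_g → ℤ/p × ℤ/p` (any `p : ℕ`, `ℤ/0 = ℤ`) the **Heisenberg obstruction**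
`ω_g(Φ) = ∑ᵢ (Φ₁(aᵢ)Φ₂(bᵢ) - Φ₂(aᵢ)Φ₁(bᵢ))` (the cup product `Φ₁ ∪ Φ₂` on the fundamental class; the
tree's `SurfaceGroupHeisenbergLift.lean`) is the reduction mod `p` of the integral form `omega ξ η (r_g)`
for integer lifts `ξ, η` of `Φ` on the generators (`cast_heisHom_a`, `cast_heisHom_b`).  By part IV
(`exists_sign_omega_lift_surfaceRelator`) and the Schreier index formula (`SchreierIndexFormula.lean`):

* `heisenbergObstruction_restrict_of_genus` — for `K ≤ S_g` (`g ≥ 1`) of finite index `n`, ANY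
  isomorphism `e : K ≃* S_h` with the Riemann–Hurwitz genus `h + n = n g + 1`, and any `Φ`:
  `ω_h(Φ|_K ∘ e⁻¹) = ± n · ω_g(Φ)`;
* `heisenbergObstruction_restrict_of_finiteIndexSubgroup` — the same for ALL `g, h, p, K, e, Φ`
  GIVEN the tree's named fact `SurfaceGroupFiniteIndexSubgroup` (finite-index subgroups of `S_g`,
  `g ≥ 2`, are surface groups of the Riemann–Hurwitz genus; `SurfaceGroupConjugacySeparable.lean`),
  which pins `h`; the cases `g = 0, 1` are settled directly.  This is VERBATIM the inline hypothesis
  `hR` ("F_res") of `Literature/IUT/HodgeTheaters/ProfiniteCompletionSurfaceBasisCharacters.lean`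
  (abc-iut-L5-t17), there justified by Brown, *Cohomology of Groups*, III (9.5)(ii) + `PD²`; here it
  is a theorem modulo `SurfaceGroupFiniteIndexSubgroup` alone.  (The Lemma 2.7 (v) conclusion itself
  was meanwhile obtained WITHOUT a degree formula, through kernels of characters, in
  `Literature/IUT/HodgeTheaters/ProfiniteCompletionSurfaceBasisCharactersFcov.lean` (abc-iut-w4-d053); the
  present general restriction formula — arbitrary finite index, arbitrary `Φ` — is recorded as
  library mathematics and settles the cell's fact-candidate "F_res" as stated.)
-/

noncomputable section

namespace Literature.Topology.FourManifolds

namespace SurfaceGroup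

open Literature.GroupTheory.CombinatorialGroupTheory Subgroup Multiplicative
open scoped commutatorElement

variable {g h : ℕ}

/-! ### Integer lifts of a pair of characters and the Heisenberg coordinates -/

/-- If the weights `ξ, η` reduce mod `p` to the two components of `Φ` on the generators, then the first
two Heisenberg coordinates of every `x ∈ F` reduce to the components of `Φ(proj x)`.
[cite: ZieschangVogtColdewey1980, 5.5.1] -/
theorem cast_heisHom_ab {p : ℕ} (Φ : SurfaceGroup g →* Multiplicative (ZMod p) × Multiplicative (ZMod p))
    (ξ η : surfaceGen g → ℤ) (hξ : ∀ i, ((ξ i : ℤ) : ZMod p) = toAdd (Φ (PresentedGroup.of i)).1)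
    (hη : ∀ i, ((η i : ℤ) : ZMod p) = toAdd (Φ (PresentedGroup.of i)).2) (x : FreeGroup (surfaceGen g)) :
    (((heisHom ξ η x).a : ℤ) : ZMod p) = toAdd (Φ (proj g x)).1 ∧
      (((heisHom ξ η x).b : ℤ) : ZMod p) = toAdd (Φ (proj g x)).2 := by
  induction x using FreeGroup.induction_on with
  | C1 => simp
  | of i =>
    rw [heisHom_of]
    exact ⟨hξ i, hη i⟩
  | mul x y hx hy =>
    rw [map_mul, Heis.mul_a, Heis.mul_b, map_mul, map_mul, Prod.fst_mul, Prod.snd_mul, toAdd_mul,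
      toAdd_mul, Int.cast_add, Int.cast_add, hx.1, hx.2, hy.1, hy.2]
    exact ⟨rfl, rfl⟩
  | inv_of i hi =>
    rw [map_inv, Heis.inv_a, Heis.inv_b, map_inv, map_inv, Prod.fst_inv, Prod.snd_inv, toAdd_inv,
      toAdd_inv, Int.cast_neg, Int.cast_neg, hi.1, hi.2]
    exact ⟨rfl, rfl⟩

/-- `(π_E z : S_g) = proj_g z` for `z ∈ E`. [cite: HatcherAT2002, §1.2 p.51] -/
theorem coe_subgroupComap_apply (K : Subgroup (SurfaceGroup g)) (z : K.comap (proj g)) :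
    (((proj g).subgroupComap K z : K) : SurfaceGroup g) = proj g (z : FreeGroup (surfaceGen g)) := rfl

/-- `S_h` is not commutative for `h ≥ 2` (`b₀, b₁` map to non-commuting transpositions under
`S_h ↠ F_h → 𝔖₃`). [cite: HatcherAT2002, §1.2 p.51] -/
theorem exists_mul_ne_mul_of_two_le (hh : 2 ≤ h) : ∃ x y : SurfaceGroup h, x * y ≠ y * x := by
  obtain ⟨h', rfl⟩ : ∃ h', h = h' + 2 := ⟨h - 2, by omega⟩
  refine ⟨b (0 : Fin (h' + 2)), b (1 : Fin (h' + 2)), fun heq => ?_⟩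
  let f : Fin (h' + 2) → Equiv.Perm (Fin 3) := fun i =>
    if i = 0 then Equiv.swap 0 1 else if i = 1 then Equiv.swap 1 2 else 1
  have h1 := congrArg (FreeGroup.lift f ∘ handlebodyProj (h' + 2)) heq
  simp only [Function.comp_apply, map_mul, handlebodyProj_b, FreeGroup.lift_apply_of] at h1
  have h0 : f 0 = Equiv.swap 0 1 := by simp [f]
  have h1' : f 1 = Equiv.swap 1 2 := by simp [f]
  rw [h0, h1'] at h1
  exact absurd h1 (by decide)

/-- `S_h` is nontrivial for `h ≥ 1` (`b₀ ↦ x₀ ≠ 1` under `S_h ↠ F_h`). [cite: HatcherAT2002, §1.2 p.51] -/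
theorem b_ne_one_of_one_le (hh : 1 ≤ h) : b (⟨0, hh⟩ : Fin h) ≠ 1 := by
  intro heq
  have := congrArg (handlebodyProj h) heq
  rw [handlebodyProj_b, map_one] at this
  exact FreeGroup.of_ne_one _ this

/-- `S_0` is trivial. [cite: HatcherAT2002, §1.2 p.51] -/
theorem subsingleton_zero : Subsingleton (SurfaceGroup 0) := by
  haveI : IsEmpty (surfaceGen 0) := by unfold surfaceGen; infer_instance
  refine ⟨fun x y => ?_⟩
  obtain ⟨x, rfl⟩ := QuotientGroup.mk'_surjective _ x
  obtain ⟨y, rfl⟩ := QuotientGroup.mk'_surjective _ y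
  rw [Subsingleton.elim x y]

/-- `S_1` is infinite. [cite: HatcherAT2002, §1.2 p.51] -/
theorem infinite_one : Infinite (SurfaceGroup 1) :=
  Infinite.of_injective _ surfaceGroupOneEquiv.symm.injective

/-! ### The restriction of the Heisenberg obstruction -/

/-- **Restriction of the Heisenberg obstruction to a finite-index subgroup of Riemann–Hurwitz genus.**
Let `1 ≤ g`, `K ≤ S_g` of finite index `n`, `e : K ≃* S_h` with `h + n = n g + 1`, `p : ℕ`, and
`Φ : S_g → ℤ/p × ℤ/p` a pair of characters.  Then the Heisenberg obstruction of `Φ|_K` transported to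
`S_h` along `e` is `± n` times that of `Φ`.  [cite: Brown1982CohomologyGroups, III (9.5)(ii)] -/
theorem heisenbergObstruction_restrict_of_genus (hg : 1 ≤ g) (K : Subgroup (SurfaceGroup g))
    [K.FiniteIndex] (e : K ≃* SurfaceGroup h) (hh : h + K.index = K.index * g + 1) (p : ℕ)
    (Φ : SurfaceGroup g →* Multiplicative (ZMod p) × Multiplicative (ZMod p)) :
    (∑ i : Fin h,
        ((toAdd ((Φ.comp (K.subtype.comp e.symm.toMonoidHom)) (SurfaceGroup.a i)).1) *
          (toAdd ((Φ.comp (K.subtype.comp e.symm.toMonoidHom)) (SurfaceGroup.b i)).2) -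
         (toAdd ((Φ.comp (K.subtype.comp e.symm.toMonoidHom)) (SurfaceGroup.a i)).2) *
          (toAdd ((Φ.comp (K.subtype.comp e.symm.toMonoidHom)) (SurfaceGroup.b i)).1))) =
        (K.index : ZMod p) * (∑ i : Fin g,
          ((toAdd (Φ (SurfaceGroup.a i)).1) * (toAdd (Φ (SurfaceGroup.b i)).2) -
           (toAdd (Φ (SurfaceGroup.a i)).2) * (toAdd (Φ (SurfaceGroup.b i)).1))) ∨
      (∑ i : Fin h,
        ((toAdd ((Φ.comp (K.subtype.comp e.symm.toMonoidHom)) (SurfaceGroup.a i)).1) *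
          (toAdd ((Φ.comp (K.subtype.comp e.symm.toMonoidHom)) (SurfaceGroup.b i)).2) -
         (toAdd ((Φ.comp (K.subtype.comp e.symm.toMonoidHom)) (SurfaceGroup.a i)).2) *
          (toAdd ((Φ.comp (K.subtype.comp e.symm.toMonoidHom)) (SurfaceGroup.b i)).1))) =
        -((K.index : ZMod p) * (∑ i : Fin g,
          ((toAdd (Φ (SurfaceGroup.a i)).1) * (toAdd (Φ (SurfaceGroup.b i)).2) -
           (toAdd (Φ (SurfaceGroup.a i)).2) * (toAdd (Φ (SurfaceGroup.b i)).1)))) := by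
  classical
  haveI hEfi : (K.comap (proj g)).FiniteIndex :=
    ⟨by rw [index_comap_proj]; exact FiniteIndex.index_ne_zero⟩
  -- the Schreier basis of `E`
  obtain ⟨ι, bE, hfin, hcard⟩ := FreeGroup.exists_freeGroupBasis_of_finiteIndex (K.comap (proj g))
  haveI := hfin
  have hι : Nat.card ι + K.index = K.index * (2 * g) + 1 := by
    rw [index_comap_proj] at hcard
    have h2 : Nat.card (surfaceGen g) = 2 * g := by
      rw [Nat.card_eq_fintype_card]; simp [surfaceGen, Fintype.card_prod, mul_comm]
    rwa [h2] at hcard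
  -- a lift `θ` of `e⁻¹` and integer lifts of `Φ`
  obtain ⟨θ, hθ⟩ := exists_lift_to_preimage K e
  let ξ : surfaceGen g → ℤ := fun i => ZMod.cast (toAdd (Φ (PresentedGroup.of i)).1)
  let η : surfaceGen g → ℤ := fun i => ZMod.cast (toAdd (Φ (PresentedGroup.of i)).2)
  have hξ : ∀ i, ((ξ i : ℤ) : ZMod p) = toAdd (Φ (PresentedGroup.of i)).1 := fun i =>
    ZMod.intCast_zmod_cast _
  have hη : ∀ i, ((η i : ℤ) : ZMod p) = toAdd (Φ (PresentedGroup.of i)).2 := fun i =>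
    ZMod.intCast_zmod_cast _
  obtain ⟨ε, hε, hω⟩ := exists_sign_omega_lift_surfaceRelator hg K e θ hθ bE hι hh
  specialize hω ξ η
  -- the Heisenberg evaluation of `F_h` through `θ`
  let H' : FreeGroup (surfaceGen h) →* Heis :=
    (heisHom ξ η).comp ((K.comap (proj g)).subtype.comp θ)
  have hH'c : (H' (surfaceRelator h)).c =
      omega ξ η ((θ (surfaceRelator h) : K.comap (proj g)) : FreeGroup (surfaceGen g)) := rfl
  -- generator data of `H'` reduce to `Ψ = Φ|_K ∘ e⁻¹`
  have hΨ : ∀ y : FreeGroup (surfaceGen h),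
      (Φ.comp (K.subtype.comp e.symm.toMonoidHom)) (proj h y) =
        Φ (proj g ((θ y : K.comap (proj g)) : FreeGroup (surfaceGen g))) := by
    intro y
    simp only [MonoidHom.coe_comp, Function.comp_apply, MulEquiv.coe_toMonoidHom, Subgroup.coe_subtype]
    rw [← coe_subgroupComap_apply K (θ y), hθ]
  have hgen : ∀ i : surfaceGen h,
      (((H' (FreeGroup.of i)).a : ℤ) : ZMod p) =
          toAdd ((Φ.comp (K.subtype.comp e.symm.toMonoidHom)) (PresentedGroup.of i)).1 ∧
        (((H' (FreeGroup.of i)).b : ℤ) : ZMod p) =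
          toAdd ((Φ.comp (K.subtype.comp e.symm.toMonoidHom)) (PresentedGroup.of i)).2 := by
    intro i
    have h1 := cast_heisHom_ab Φ ξ η hξ hη ((θ (FreeGroup.of i) : K.comap (proj g)) : _)
    rw [← hΨ] at h1
    exact h1
  -- the central coordinate of `H'(r_h)` is the form of the generator data (balanced word)
  obtain ⟨-, -, hc⟩ := hom_mk_abc H' (surfaceWordStd h)
  have hrg : omega ξ η (surfaceRelator g) =
      ∑ i : Fin g, (ξ (i, false) * η (i, true) - ξ (i, true) * η (i, false)) := by
    rw [← mk_surfaceWordStd, omega_surfaceWordStd]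
  rw [mk_surfaceWordStd, ((isQuadratic_surfaceWordStd h).isBalanced).lsum_eq_zero, add_zero,
    ← omega_mk, omega_surfaceWordStd, hH'c, hω, hrg] at hc
  -- cast `hc : ε * (n * ∑ (ξ…)) = ∑ (ξ''…)` to `ZMod p`
  have hcast := congrArg (fun z : ℤ => (z : ZMod p)) hc
  simp only [Int.cast_mul, Int.cast_sum, Int.cast_sub, Int.cast_natCast] at hcast
  -- rewrite generator data
  have hL : ∀ i : Fin h,
      (((H' (FreeGroup.of (i, false))).a : ℤ) : ZMod p) * (((H' (FreeGroup.of (i, true))).b : ℤ) : ZMod p) -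
        (((H' (FreeGroup.of (i, true))).a : ℤ) : ZMod p) * (((H' (FreeGroup.of (i, false))).b : ℤ) : ZMod p) =
      (toAdd ((Φ.comp (K.subtype.comp e.symm.toMonoidHom)) (SurfaceGroup.a i)).1) *
          (toAdd ((Φ.comp (K.subtype.comp e.symm.toMonoidHom)) (SurfaceGroup.b i)).2) -
        (toAdd ((Φ.comp (K.subtype.comp e.symm.toMonoidHom)) (SurfaceGroup.a i)).2) *
          (toAdd ((Φ.comp (K.subtype.comp e.symm.toMonoidHom)) (SurfaceGroup.b i)).1) := by
    intro i
    rw [(hgen (i, false)).1, (hgen (i, true)).2, (hgen (i, true)).1, (hgen (i, false)).2]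
    change _ = (toAdd ((Φ.comp (K.subtype.comp e.symm.toMonoidHom)) (PresentedGroup.of (i, false))).1) *
        (toAdd ((Φ.comp (K.subtype.comp e.symm.toMonoidHom)) (PresentedGroup.of (i, true))).2) -
      (toAdd ((Φ.comp (K.subtype.comp e.symm.toMonoidHom)) (PresentedGroup.of (i, false))).2) *
        (toAdd ((Φ.comp (K.subtype.comp e.symm.toMonoidHom)) (PresentedGroup.of (i, true))).1)
    ring
  have hR : ∀ i : Fin g,
      ((ξ (i, false) : ℤ) : ZMod p) * ((η (i, true) : ℤ) : ZMod p) -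
        ((ξ (i, true) : ℤ) : ZMod p) * ((η (i, false) : ℤ) : ZMod p) =
      (toAdd (Φ (SurfaceGroup.a i)).1) * (toAdd (Φ (SurfaceGroup.b i)).2) -
        (toAdd (Φ (SurfaceGroup.a i)).2) * (toAdd (Φ (SurfaceGroup.b i)).1) := by
    intro i
    rw [hξ, hη, hξ, hη]
    change (toAdd (Φ (PresentedGroup.of (i, false))).1) * (toAdd (Φ (PresentedGroup.of (i, true))).2) -
        (toAdd (Φ (PresentedGroup.of (i, true))).1) * (toAdd (Φ (PresentedGroup.of (i, false))).2) =
      (toAdd (Φ (PresentedGroup.of (i, false))).1) * (toAdd (Φ (PresentedGroup.of (i, true))).2) -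
        (toAdd (Φ (PresentedGroup.of (i, false))).2) * (toAdd (Φ (PresentedGroup.of (i, true))).1)
    ring
  simp only [hL, hR] at hcast
  rcases hε with rfl | rfl
  · left; rw [← hcast]; ring
  · right; rw [← hcast]; ring

/-- **Restriction degree `± [S_g : K]`, for every finite-index `K` and every `e : K ≃* S_h`, modulo
the named fact `SurfaceGroupFiniteIndexSubgroup`** (which supplies the Riemann–Hurwitz genus for
`g ≥ 2`; `g = 0, 1` are settled directly).  This is verbatim the hypothesis `hR` of
`ProfiniteCompletionSurfaceBasisCharacters.lean`. [cite: Brown1982CohomologyGroups, III (9.5)(ii)] -/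
theorem heisenbergObstruction_restrict_of_finiteIndexSubgroup
    (hF : Literature.GroupTheory.CombinatorialGroupTheory.SurfaceGroupFiniteIndexSubgroup)
    (g h p : ℕ) (K : Subgroup (SurfaceGroup g)) (hK : K.FiniteIndex)
    (e : K ≃* SurfaceGroup h)
    (Φ : SurfaceGroup g →* Multiplicative (ZMod p) × Multiplicative (ZMod p)) :
    (∑ i : Fin h,
        ((toAdd ((Φ.comp (K.subtype.comp e.symm.toMonoidHom)) (SurfaceGroup.a i)).1) *
          (toAdd ((Φ.comp (K.subtype.comp e.symm.toMonoidHom)) (SurfaceGroup.b i)).2) -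
         (toAdd ((Φ.comp (K.subtype.comp e.symm.toMonoidHom)) (SurfaceGroup.a i)).2) *
          (toAdd ((Φ.comp (K.subtype.comp e.symm.toMonoidHom)) (SurfaceGroup.b i)).1))) =
        (K.index : ZMod p) * (∑ i : Fin g,
          ((toAdd (Φ (SurfaceGroup.a i)).1) * (toAdd (Φ (SurfaceGroup.b i)).2) -
           (toAdd (Φ (SurfaceGroup.a i)).2) * (toAdd (Φ (SurfaceGroup.b i)).1))) ∨
      (∑ i : Fin h,
        ((toAdd ((Φ.comp (K.subtype.comp e.symm.toMonoidHom)) (SurfaceGroup.a i)).1) *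
          (toAdd ((Φ.comp (K.subtype.comp e.symm.toMonoidHom)) (SurfaceGroup.b i)).2) -
         (toAdd ((Φ.comp (K.subtype.comp e.symm.toMonoidHom)) (SurfaceGroup.a i)).2) *
          (toAdd ((Φ.comp (K.subtype.comp e.symm.toMonoidHom)) (SurfaceGroup.b i)).1))) =
        -((K.index : ZMod p) * (∑ i : Fin g,
          ((toAdd (Φ (SurfaceGroup.a i)).1) * (toAdd (Φ (SurfaceGroup.b i)).2) -
           (toAdd (Φ (SurfaceGroup.a i)).2) * (toAdd (Φ (SurfaceGroup.b i)).1)))) := by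
  haveI := hK
  rcases Nat.lt_or_ge g 1 with hg | hg
  · -- `g = 0`: everything is trivial and `h = 0`
    obtain rfl : g = 0 := by omega
    haveI := subsingleton_zero
    have hh0 : h = 0 := by
      by_contra hne
      have hb := b_ne_one_of_one_le (h := h) (by omega)
      apply hb
      have : Subsingleton (SurfaceGroup h) := ⟨fun x y => e.symm.injective (Subsingleton.elim _ _)⟩
      exact Subsingleton.elim _ _
    subst hh0
    left
    simp
  · -- `g ≥ 1`: determine `h` (Riemann–Hurwitz) and apply the degree theorem
    have hh : h + K.index = K.index * g + 1 := by
      rcases Nat.lt_or_ge g 2 with hg1 | hg2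
      · -- `g = 1`: `K` is commutative and infinite, so `h = 1`
        obtain rfl : g = 1 := by omega
        have hcomm : ∀ x y : SurfaceGroup h, x * y = y * x := fun x y =>
          e.symm.injective (Subtype.ext (by
            rw [map_mul, map_mul, Subgroup.coe_mul, Subgroup.coe_mul]
            exact mul_comm_one _ _))
        have hle : h ≤ 1 := by
          by_contra hlt
          obtain ⟨x, y, hxy⟩ := exists_mul_ne_mul_of_two_le (h := h) (by omega)
          exact hxy (hcomm x y)
        have hne : h ≠ 0 := by
          rintro rfl
          haveI := subsingleton_zero
          haveI : Subsingleton K := ⟨fun x y => e.injective (Subsingleton.elim _ _)⟩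
          have hbot : K = ⊥ := Subgroup.eq_bot_of_subsingleton K
          have hidx : K.index = 0 := by
            rw [hbot, Subgroup.index_bot]
            haveI := infinite_one
            exact Nat.card_eq_zero_of_infinite
          exact FiniteIndex.index_ne_zero hidx
        omega
      · obtain ⟨h₀, hh₀, ⟨e₀⟩⟩ := hF g hg2 K hK
        have hfin₀ := (finrank_additive_abelianization_of_mulEquiv (e.symm.trans e₀)).1
        have hfin := (finrank_additive_abelianization_surfaceGroup h).1
        have hhh : h = h₀ := by omega
        subst hhh
        rw [hh₀]
        obtain ⟨g', rfl⟩ : ∃ g', g = g' + 1 := ⟨g - 1, by omega⟩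
        simp only [Nat.add_sub_cancel]
        ring
    exact heisenbergObstruction_restrict_of_genus hg K e hh p Φ

end SurfaceGroup

end Literature.Topology.FourManifolds
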